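import Summits.Ventures.HSemireg.WedgeHankelRecurrenceKharitonov

/-!
# Venture HSemireg — **KHARITONOV'S THEOREM IN THE COEFFICIENTS OF `p = Σ_k a_k s^k`** (degree `n ≥ 3` fixed, boxes `l_k ≤ a_k ≤ u_k`, `l_n > 0`): the whole interval family is Hurwitz iff
# the four Kharitonov polynomials `K_1 = l_0 + l_1 s + u_2 s² + u_3 s³ + l_4 s⁴ + ⋯`, `K_3 = l_0 + u_1 s + u_2 s² + l_3 s³ + ⋯`, `K_4 = u_0 + l_1 s + l_2 s² + u_3 s³ + ⋯`,
# `K_2 = u_0 + u_1 s + l_2 s² + l_3 s³ + ⋯` are Hurwitz — N256 transported through the even ∕ odd parts `a_{2j} ∕ a_{2j+1}` (`p = f(s²) + s·g(s²)`, `f = contract₂ p`, `g = contract₂ (p/s)`)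

HONEST FRAMING. Part of the Lean index of the computation cell `pub-hsemireg` (seat p10 gen 41, Sunday typer «UNIFORM-IN-n»).
REAL POLYNOMIALS ONLY (N256 + N211's decomposition `p = (contract 2 p)(X²) + X·(contract 2 (p/X))(X²)` + N213's coefficient dictionary): no variety, no cohomology theory, no sheaf, no Ext
group and no semiregularity map is constructed here; nothing here says that HC / HC_CM / HC_AV holds; no Literature fact (unproved `Prop`) is declared or used.  Custodian versions as in
`WedgeHankelSiegelIdeal` (1/3).
SOURCES (cited).  V. L. Kharitonov, Differ. Uravn. 14 (1978) 2086–2088 (statement as in the header); S. P. Bhattacharyya, H. Chapellat, L. H. Keel, *Robust Control: The Parametric Approach*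
(1995), Thm 5.1 («`K¹(s) = x_0⁻ + x_1⁻ s + x_2⁺ s² + x_3⁺ s³ + x_4⁻ s⁴ + ⋯`, `K²(s) = x_0⁻ + x_1⁺ s + x_2⁺ s² + x_3⁻ s³ + ⋯`, `K³(s) = x_0⁺ + x_1⁻ s + x_2⁻ s² + x_3⁺ s³ + ⋯`,
`K⁴(s) = x_0⁺ + x_1⁺ s + x_2⁻ s² + x_3⁻ s³ + ⋯`»).
DICTIONARY.  The four polynomials are written in the split form `f(X²) + X·g(X²)` with `f = Σ_j C(l_{2j} or u_{2j}) X^j` (lower value at even `j` = indices `≡ 0 (mod 4)`, upper at odd `j` =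
indices `≡ 2 (mod 4)`, or the reverse) and `g = Σ_j C(l_{2j+1} or u_{2j+1}) X^j` likewise; their coefficient patterns by `k mod 4` are `(l,l,u,u) = K¹`, `(l,u,u,l) = K²`, `(u,l,l,u) = K³`,
`(u,u,l,l) = K⁴` in the numbering of Bhattacharyya–Chapellat–Keel.  Hurwitz = all complex roots in `re < 0`.
DEDUP DISCLOSURE (`rg -n 'kharitonov' Summits`, 2026-09-02): N227 (degrees 2, 3), N256 (split form).  The 4 names below: 0 hits tree-wide.

WHAT IS IN THE TREE.  N256 `kharitonov_of_even ∕ _of_odd`, `coeff_sum_C_mul_X_pow`, `natDegree_sum_C_mul_X_pow(_le)`; N211 `eq_expand_contract_add_X_mul_expand_contract`, `natDegree_parts_of_even ∕ _of_odd`,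
`natDegree_even_add_odd_of_lt_left ∕ _of_le_right`; N213 `coeff_even_eq`, `coeff_odd_eq`; Mathlib `Polynomial.coeff_contract`, `coeff_divX`, `Nat.even_or_odd'`.
THIS FILE (namespace `Summit.Ventures.HSemireg.Wedge.HankelOuter` continued; CHAINED on N256; 0 definitions):
* §1022 `coeff_box_parts` (the boxes of `p` give the boxes of its even ∕ odd parts), `kharitonovPair_mem_box` (a split-form polynomial with box parts is a member),
  **`kharitonov_coefficients_of_even`** (degree `2m + 4`), **`kharitonov_coefficients_of_odd`** (degree `2m + 3`).
CAVEATS.  Degrees `1, 2`: N227.  Nothing Ext-side.  New names only.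
-/

open Module Polynomial
open scoped Matrix Polynomial

namespace Summit.Ventures.HSemireg.Wedge.HankelOuter

/-! ## §1022. Kharitonov's theorem in the coefficients of `p` -/

/-- The boxes of `p` give boxes for its even part `contract 2 p` (`f_j = a_{2j}`) and odd part `contract 2 (p/X)` (`g_j = a_{2j+1}`). [N211 ∕ N213 dictionary; this file, §1022] -/
theorem coeff_box_parts {n : ℕ} {l u : ℕ → ℝ} {p : ℝ[X]} (hbox : ∀ k, k ≤ n → l k ≤ p.coeff k ∧ p.coeff k ≤ u k) :
    (∀ j, 2 * j ≤ n → l (2 * j) ≤ (contract 2 p).coeff j ∧ (contract 2 p).coeff j ≤ u (2 * j))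
      ∧ ∀ j, 2 * j + 1 ≤ n → l (2 * j + 1) ≤ (contract 2 p.divX).coeff j ∧ (contract 2 p.divX).coeff j ≤ u (2 * j + 1) := by
  refine ⟨fun j hj => ?_, fun j hj => ?_⟩
  · rw [coeff_contract two_ne_zero, show j * 2 = 2 * j from mul_comm _ _]
    exact hbox _ hj
  · rw [coeff_contract two_ne_zero, coeff_divX, show j * 2 = 2 * j from mul_comm _ _]
    exact hbox _ hj

/-- A split-form polynomial `F(X²) + X·G(X²)` whose parts have box coefficients (`F_j ∈ [l_{2j}, u_{2j}]` whenever `2j ≤ n`, `G_j ∈ [l_{2j+1}, u_{2j+1}]` whenever `2j + 1 ≤ n`) is a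
member of the box of `p`-coefficients up to `n`. [N213 dictionary; this file, §1022] -/
theorem kharitonovPair_mem_box {n : ℕ} {l u : ℕ → ℝ} {F G : ℝ[X]}
    (hFb : ∀ j, 2 * j ≤ n → l (2 * j) ≤ F.coeff j ∧ F.coeff j ≤ u (2 * j)) (hGb : ∀ j, 2 * j + 1 ≤ n → l (2 * j + 1) ≤ G.coeff j ∧ G.coeff j ≤ u (2 * j + 1)) :
    ∀ k, k ≤ n → l k ≤ (expand ℝ 2 F + Polynomial.X * expand ℝ 2 G).coeff k ∧ (expand ℝ 2 F + Polynomial.X * expand ℝ 2 G).coeff k ≤ u k := by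
  intro k hk
  obtain ⟨j, rfl | rfl⟩ := Nat.even_or_odd' k
  · rw [coeff_even_eq]
    exact hFb j hk
  · rw [coeff_odd_eq]
    exact hGb j hk

/-- **KHARITONOV'S THEOREM IN THE COEFFICIENTS, EVEN DEGREE `n = 2m + 4`.**  With boxes `l_k ≤ a_k ≤ u_k` (`k ≤ n`, `l_k ≤ u_k`, `0 < l_n`): every real polynomial of degree `n` with
coefficients in the boxes is Hurwitz iff the four Kharitonov polynomials (split form, see the header) are Hurwitz. [Kharitonov 1978; Bhattacharyya–Chapellat–Keel Thm 5.1; this file, §1022] -/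
theorem kharitonov_coefficients_of_even (m : ℕ) {l u : ℕ → ℝ} (hlu : ∀ k, k ≤ 2 * m + 4 → l k ≤ u k) (htop : 0 < l (2 * m + 4)) :
    (∀ p : ℝ[X], p.natDegree = 2 * m + 4 → (∀ k, k ≤ 2 * m + 4 → l k ≤ p.coeff k ∧ p.coeff k ≤ u k) → ∀ z ∈ (p.map (algebraMap ℝ ℂ)).roots, z.re < 0)
      ↔ (∀ z ∈ ((expand ℝ 2 (∑ k ∈ Finset.range (m + 3), C (if Even k then l (2 * k) else u (2 * k)) * X ^ k)
              + Polynomial.X * expand ℝ 2 (∑ k ∈ Finset.range (m + 2), C (if Even k then l (2 * k + 1) else u (2 * k + 1)) * X ^ k)).map (algebraMap ℝ ℂ)).roots, z.re < 0)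
        ∧ (∀ z ∈ ((expand ℝ 2 (∑ k ∈ Finset.range (m + 3), C (if Even k then l (2 * k) else u (2 * k)) * X ^ k)
              + Polynomial.X * expand ℝ 2 (∑ k ∈ Finset.range (m + 2), C (if Even k then u (2 * k + 1) else l (2 * k + 1)) * X ^ k)).map (algebraMap ℝ ℂ)).roots, z.re < 0)
        ∧ (∀ z ∈ ((expand ℝ 2 (∑ k ∈ Finset.range (m + 3), C (if Even k then u (2 * k) else l (2 * k)) * X ^ k)
              + Polynomial.X * expand ℝ 2 (∑ k ∈ Finset.range (m + 2), C (if Even k then l (2 * k + 1) else u (2 * k + 1)) * X ^ k)).map (algebraMap ℝ ℂ)).roots, z.re < 0)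
        ∧ (∀ z ∈ ((expand ℝ 2 (∑ k ∈ Finset.range (m + 3), C (if Even k then u (2 * k) else l (2 * k)) * X ^ k)
              + Polynomial.X * expand ℝ 2 (∑ k ∈ Finset.range (m + 2), C (if Even k then u (2 * k + 1) else l (2 * k + 1)) * X ^ k)).map (algebraMap ℝ ℂ)).roots, z.re < 0) := by
  have hlhu : ∀ k, k ≤ m + 2 → (fun j => l (2 * j)) k ≤ (fun j => u (2 * j)) k := fun k hk => hlu _ (by omega)
  have hlgu : ∀ k, k ≤ m + 1 → (fun j => l (2 * j + 1)) k ≤ (fun j => u (2 * j + 1)) k := fun k hk => hlu _ (by omega)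
  have htop' : 0 < (fun j => l (2 * j)) (m + 2) := by simpa only [show 2 * (m + 2) = 2 * m + 4 by ring] using htop
  have hK := kharitonov_of_even m (lh := fun j => l (2 * j)) (uh := fun j => u (2 * j)) (lg := fun j => l (2 * j + 1)) (ug := fun j => u (2 * j + 1)) hlhu hlgu htop'
  rw [← hK]
  constructor
  · -- members in the `p`-box ⇒ members in the split box
    intro H f g hf hg hfb hgb
    have hcoef : 0 < f.coeff (m + 2) := htop'.trans_le (hfb _ le_rfl).1
    have hf' : f.natDegree = m + 2 := le_antisymm hf (le_natDegree_of_ne_zero hcoef.ne')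
    refine H _ ?_ (kharitonovPair_mem_box (fun j hj => hfb j (by omega)) (fun j hj => hgb j (by omega)))
    rw [natDegree_even_add_odd_of_lt_left (by omega), hf']
    ring
  · -- members in the split box ⇒ members in the `p`-box
    intro H p hp hpb
    rw [eq_expand_contract_add_X_mul_expand_contract p] at hp ⊢
    obtain ⟨hf, hg⟩ := natDegree_parts_of_even (m := m + 1) (f := contract 2 p) (g := contract 2 p.divX) (by rw [hp]; ring)
    obtain ⟨hfb, hgb⟩ := coeff_box_parts hpb
    exact H _ _ hf.le (by omega) (fun j hj => hfb j (by omega)) (fun j hj => hgb j (by omega))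

/-- **KHARITONOV'S THEOREM IN THE COEFFICIENTS, ODD DEGREE `n = 2m + 3`.**  With boxes `l_k ≤ a_k ≤ u_k` (`k ≤ n`, `l_k ≤ u_k`, `0 < l_n`): every real polynomial of degree `n` with
coefficients in the boxes is Hurwitz iff the four Kharitonov polynomials are Hurwitz. [Kharitonov 1978; Bhattacharyya–Chapellat–Keel Thm 5.1; this file, §1022] -/
theorem kharitonov_coefficients_of_odd (m : ℕ) {l u : ℕ → ℝ} (hlu : ∀ k, k ≤ 2 * m + 3 → l k ≤ u k) (htop : 0 < l (2 * m + 3)) :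
    (∀ p : ℝ[X], p.natDegree = 2 * m + 3 → (∀ k, k ≤ 2 * m + 3 → l k ≤ p.coeff k ∧ p.coeff k ≤ u k) → ∀ z ∈ (p.map (algebraMap ℝ ℂ)).roots, z.re < 0)
      ↔ (∀ z ∈ ((expand ℝ 2 (∑ k ∈ Finset.range (m + 2), C (if Even k then l (2 * k) else u (2 * k)) * X ^ k)
              + Polynomial.X * expand ℝ 2 (∑ k ∈ Finset.range (m + 2), C (if Even k then l (2 * k + 1) else u (2 * k + 1)) * X ^ k)).map (algebraMap ℝ ℂ)).roots, z.re < 0)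
        ∧ (∀ z ∈ ((expand ℝ 2 (∑ k ∈ Finset.range (m + 2), C (if Even k then l (2 * k) else u (2 * k)) * X ^ k)
              + Polynomial.X * expand ℝ 2 (∑ k ∈ Finset.range (m + 2), C (if Even k then u (2 * k + 1) else l (2 * k + 1)) * X ^ k)).map (algebraMap ℝ ℂ)).roots, z.re < 0)
        ∧ (∀ z ∈ ((expand ℝ 2 (∑ k ∈ Finset.range (m + 2), C (if Even k then u (2 * k) else l (2 * k)) * X ^ k)
              + Polynomial.X * expand ℝ 2 (∑ k ∈ Finset.range (m + 2), C (if Even k then l (2 * k + 1) else u (2 * k + 1)) * X ^ k)).map (algebraMap ℝ ℂ)).roots, z.re < 0)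
        ∧ (∀ z ∈ ((expand ℝ 2 (∑ k ∈ Finset.range (m + 2), C (if Even k then u (2 * k) else l (2 * k)) * X ^ k)
              + Polynomial.X * expand ℝ 2 (∑ k ∈ Finset.range (m + 2), C (if Even k then u (2 * k + 1) else l (2 * k + 1)) * X ^ k)).map (algebraMap ℝ ℂ)).roots, z.re < 0) := by
  have hlhu : ∀ k, k ≤ m + 1 → (fun j => l (2 * j)) k ≤ (fun j => u (2 * j)) k := fun k hk => hlu _ (by omega)
  have hlgu : ∀ k, k ≤ m + 1 → (fun j => l (2 * j + 1)) k ≤ (fun j => u (2 * j + 1)) k := fun k hk => hlu _ (by omega)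
  have htop' : 0 < (fun j => l (2 * j + 1)) (m + 1) := by simpa only [show 2 * (m + 1) + 1 = 2 * m + 3 by ring] using htop
  have hK := kharitonov_of_odd m (lh := fun j => l (2 * j)) (uh := fun j => u (2 * j)) (lg := fun j => l (2 * j + 1)) (ug := fun j => u (2 * j + 1)) hlhu hlgu htop'
  rw [← hK]
  constructor
  · intro H f g hf hg hfb hgb
    have hcoef : 0 < g.coeff (m + 1) := htop'.trans_le (hgb _ le_rfl).1
    have hg' : g.natDegree = m + 1 := le_antisymm hg (le_natDegree_of_ne_zero hcoef.ne')
    have hg0 : g ≠ 0 := by rintro rfl; simp at hcoef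
    refine H _ ?_ (kharitonovPair_mem_box (fun j hj => hfb j (by omega)) (fun j hj => hgb j (by omega)))
    rw [natDegree_even_add_odd_of_le_right hg0 (by omega), hg']
    ring
  · intro H p hp hpb
    rw [eq_expand_contract_add_X_mul_expand_contract p] at hp ⊢
    obtain ⟨hg, hf⟩ := natDegree_parts_of_odd (m := m + 1) (f := contract 2 p) (g := contract 2 p.divX) (by rw [hp]; ring)
    obtain ⟨hfb, hgb⟩ := coeff_box_parts hpb
    exact H _ _ hf hg.le (fun j hj => hfb j (by omega)) (fun j hj => hgb j (by omega))

end Summit.Ventures.HSemireg.Wedge.HankelOuter
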